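import Literature.Analysis.OperatorTheory.PositiveSqrtSmooth
import HarnessLib

/-!
# The compatible complex structure `J_{g,ω}` as a smooth function of `(g, ω)` (polar form)

Topic `Literature/Geometry/Symplectic`. McDuff–Salamon, *Introduction to Symplectic Topology*
(3rd ed. 2017), **Prop. 2.5.6** (the `GL(V)`-equivariant smooth map `𝔐𝔢𝔱(V) × Ω(V) → 𝒥(V)`,
`(g, ω) ↦ J_{g,ω} := Q⁻¹ A`, `ω = g(A·, ·)`, `Q = (-A²)^{1/2}`; eqs. (2.5.12)–(2.5.14)), in the
form needed to build a SMOOTH `ω`-compatible almost complex structure on a manifold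
(Prop. 4.1.1 (i): apply `J_{g,ω}` fibrewise to a Riemannian metric `g` and the symplectic form).

We work on a fixed finite-dimensional real inner product space `E` (the model fibre) and encode
the inner product `g` and the `2`-form `ω` by their Gram operators with respect to `⟪·, ·⟫`:
`g(v, w) = ⟪G v, w⟫` with `G` symmetric positive definite (`IsPosDefSymm`,
`PositiveSqrtSmooth.lean`) and `ω(v, w) = ⟪Ω v, w⟫` with `Ω` skew and injective
(`IsSkewNondeg`). Then, with `C := G^{1/2}` (`posSqrt`), the `g`-orthonormalising isometry,
`Ω̃ := C⁻¹ Ω C⁻¹` and the Euclidean polar part `polarJ Ω̃ := (-Ω̃²)^{-1/2} Ω̃`,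

`polarJOfMetric G Ω := C⁻¹ · polarJ (C⁻¹ Ω C⁻¹) · C = J_{g,ω}`.

* `polarJ`: `J² = -1`, `⟪Ω (J v), J w⟫ = ⟪Ω v, w⟫`, `⟪Ω v, J v⟫ > 0`, `⟪J v, J w⟫ = ⟪v, w⟫`
  (McDuff–Salamon (2.5.14), `J_{g,ω} ∈ 𝒥(V, ω) ∩ 𝒥(V, g)`, Euclidean `g`); the key lemma
  `posSqrt_comm_of_comm` ("`Q` commutes with `A`").
* `polarJOfMetric`: the same four properties relative to `g = ⟪G·, ·⟫`
  (`polarJOfMetric_mul_self`, `inner_gram_polarJOfMetric`, `inner_gram_self_polarJOfMetric_pos`,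
  `inner_metric_polarJOfMetric`).
* **Uniqueness** `eq_polarJOfMetric`: `J_{g,ω}` is the ONLY complex structure that is at once
  `ω`-compatible and `g`-orthogonal (the polar decomposition `A = Q J` is unique: `Q' := -A J'`
  is a `g`-positive square root of `-A²`; McDuff–Salamon Prop. 2.5.6 (i), (2.5.11), and
  Exercise 2.5.15), whence **`GL`-equivariance** `polarJOfMetric_conj`:
  `J_{Φ_* g, Φ_* ω} = Φ J_{g,ω} Φ⁻¹`.
* **Smoothness** `contDiffOn_polarJOfMetric`: `(G, Ω) ↦ J` is `C^∞` on
  `{G pos. def. symmetric} × {Ω skew nondegenerate}` (McDuff–Salamon Prop. 2.5.6: "the map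
  (2.5.9) is smooth"; from `contDiffOn_posSqrt`).

Everything is proved; no named facts. The eigenbasis construction of
`CompatibleComplexStructure.lean` (the case `G = 1`, inner product by instance) is the pointwise
existence statement; this file is the parametrised version.

## References

* D. McDuff, D. Salamon, *Introduction to Symplectic Topology*, 3rd ed., OUP (2017), §2.5,
  Prop. 2.5.6 (i) and its proof, Step 1, eqs. (2.5.9)–(2.5.14); Exercise 2.5.15.
  [McDuffSalamon2017]
-/

noncomputable section

open scoped Topology ContDiff RealInnerProductSpace
open Filter Module Literature.Analysis.OperatorTheory

namespace Literature.Geometry.Symplectic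

variable {E : Type*} [NormedAddCommGroup E] [InnerProductSpace ℝ E] [FiniteDimensional ℝ E]

/-! ### The positive square root commutes with the commutant -/

/-- **`√P` commutes with every operator commuting with `P`** (`P` symmetric positive definite):
an operator `T` commuting with `P` preserves its eigenspaces, and `√P` is a scalar on each of
them (McDuff–Salamon 2017, proof of Prop. 2.5.6: "since `Q² = -A²` commutes with `A` so does
`Q`"). [cite: McDuffSalamon2017, Prop. 2.5.6 Step 1] -/
theorem posSqrt_comm_of_comm {P T : E →L[ℝ] E} (hP : IsPosDefSymm P) (h : T * P = P * T) :
    T * posSqrt P = posSqrt P * T := by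
  classical
  rw [hP.posSqrt_eq]
  set b := hP.isSymmetric.eigenvectorBasis rfl with hb
  set μ := hP.isSymmetric.eigenvalues rfl with hμ
  have hPb : ∀ j, P (b j) = μ j • b j := fun j ↦ hP.isSymmetric.apply_eigenvectorBasis rfl j
  -- the coefficients `⟪bᵢ, T bⱼ⟫` vanish unless `μᵢ = μⱼ`
  have hcross : ∀ i j, μ i ≠ μ j → ⟪b i, T (b j)⟫ = 0 := by
    intro i j hij
    have h1 : ⟪b i, T (P (b j))⟫ = μ j * ⟪b i, T (b j)⟫ := by
      rw [hPb, map_smul, real_inner_smul_right]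
    have h2 : ⟪b i, T (P (b j))⟫ = μ i * ⟪b i, T (b j)⟫ := by
      have h3 : T (P (b j)) = P (T (b j)) := congrArg (fun S : E →L[ℝ] E ↦ S (b j)) h
      rw [h3, ← hP.symm, hPb, real_inner_smul_left]
    have h4 : (μ i - μ j) * ⟪b i, T (b j)⟫ = 0 := by rw [sub_mul, ← h2, ← h1, sub_self]
    exact (mul_eq_zero.1 h4).resolve_left (sub_ne_zero.2 hij)
  -- compare the two sides on the eigenbasis, coefficient by coefficient
  have hlin : ((T * diagOp b fun i ↦ Real.sqrt (μ i)) : E →ₗ[ℝ] E) =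
      ((diagOp b (fun i ↦ Real.sqrt (μ i)) * T : E →L[ℝ] E) : E →ₗ[ℝ] E) := by
    refine b.toBasis.ext fun j ↦ ?_
    simp only [OrthonormalBasis.coe_toBasis, ContinuousLinearMap.coe_coe]
    change T (diagOp b (fun i ↦ Real.sqrt (μ i)) (b j)) = diagOp b (fun i ↦ Real.sqrt (μ i)) (T (b j))
    rw [diagOp_basis, map_smul]
    refine ext_inner_basis b fun i ↦ ?_
    rw [real_inner_smul_right, inner_basis_diagOp]
    by_cases hij : μ i = μ j
    · rw [hij]
    · rw [hcross i j hij, mul_zero, mul_zero]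
  exact ContinuousLinearMap.coe_injective hlin

/-- The inverse of a symmetric positive definite operator is symmetric positive definite.
[folklore] -/
theorem _root_.Literature.Analysis.OperatorTheory.IsPosDefSymm.ringInverse {S : E →L[ℝ] E}
    (hS : IsPosDefSymm S) : IsPosDefSymm (Ring.inverse S) := by
  have hu := hS.isUnit
  have hSR : ∀ v, S (Ring.inverse S v) = v := fun v ↦ by
    have := congrArg (fun T : E →L[ℝ] E ↦ T v) (Ring.mul_inverse_cancel S hu)
    exact this
  have hsymm : ∀ x y, ⟪Ring.inverse S x, y⟫ = ⟪x, Ring.inverse S y⟫ := by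
    intro x y
    conv_lhs => rw [← hSR y]
    rw [← hS.symm, hSR]
  refine ⟨hsymm, fun v hv ↦ ?_⟩
  have hRv : Ring.inverse S v ≠ 0 := by
    intro h0
    apply hv
    rw [← hSR v, h0, map_zero]
  have h1 := hS.pos _ hRv
  rw [hSR, real_inner_comm] at h1
  exact h1

/-! ### Skew nondegenerate operators (Gram operators of symplectic forms) -/

/-- The Gram operator `Ω` of a nondegenerate skew form `ω(v, w) = ⟪Ω v, w⟫`: skew
(`⟪Ω x, y⟫ = -⟪x, Ω y⟫`) with trivial kernel. [folklore] -/
structure IsSkewNondeg (Ω : E →L[ℝ] E) : Prop where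
  /-- skew-symmetry -/
  skew : ∀ x y, ⟪Ω x, y⟫ = -⟪x, Ω y⟫
  /-- nondegeneracy -/
  ne_zero : ∀ v, v ≠ 0 → Ω v ≠ 0

omit [FiniteDimensional ℝ E] in
/-- `⟪Ω v, v⟫ = 0` for a skew operator. [folklore] -/
theorem IsSkewNondeg.inner_self {Ω : E →L[ℝ] E} (h : IsSkewNondeg Ω) (v : E) : ⟪Ω v, v⟫ = 0 := by
  have h1 := h.skew v v
  have h2 : ⟪v, Ω v⟫ = ⟪Ω v, v⟫ := real_inner_comm _ _
  linarith

omit [FiniteDimensional ℝ E] in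
/-- **`P = -Ω²` is symmetric positive definite** (`⟪P x, y⟫ = ⟪Ω x, Ω y⟫`; McDuff–Salamon 2017,
proof of Prop. 2.5.6: `P = A*A`). [cite: McDuffSalamon2017, Prop. 2.5.6 Step 1] -/
theorem IsSkewNondeg.isPosDefSymm_neg_mul_self {Ω : E →L[ℝ] E} (h : IsSkewNondeg Ω) :
    IsPosDefSymm (-(Ω * Ω)) := by
  refine ⟨fun x y ↦ ?_, fun v hv ↦ ?_⟩
  · change ⟪-(Ω (Ω x)), y⟫ = ⟪x, -(Ω (Ω y))⟫
    rw [inner_neg_left, inner_neg_right, h.skew (Ω x) y, neg_neg, ← h.skew x (Ω y)]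
  · change 0 < ⟪-(Ω (Ω v)), v⟫
    rw [inner_neg_left, h.skew (Ω v) v, neg_neg, real_inner_self_eq_norm_sq]
    have := h.ne_zero v hv
    positivity

/-! ### The Euclidean polar part `polarJ Ω = (-Ω²)^{-1/2} Ω` -/

/-- `Q := (-Ω²)^{1/2}`, the positive square root (McDuff–Salamon 2017, (2.5.13)). [cite: McDuffSalamon2017, Prop. 2.5.6 (2.5.13)] -/
def polarSqrt (Ω : E →L[ℝ] E) : E →L[ℝ] E := posSqrt (-(Ω * Ω))

/-- **`J := Q⁻¹ Ω`** (McDuff–Salamon 2017, (2.5.14), with `A = Ω` for the Euclidean inner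
product). [cite: McDuffSalamon2017, Prop. 2.5.6 (2.5.14)] -/
def polarJ (Ω : E →L[ℝ] E) : E →L[ℝ] E := Ring.inverse (polarSqrt Ω) * Ω

section Euclidean

variable {Ω : E →L[ℝ] E} (h : IsSkewNondeg Ω)
include h

/-- `Q` is symmetric positive definite. [cite: McDuffSalamon2017, Prop. 2.5.6 Step 1] -/
theorem isPosDefSymm_polarSqrt : IsPosDefSymm (polarSqrt Ω) :=
  h.isPosDefSymm_neg_mul_self.isPosDefSymm_posSqrt

/-- `Q · Q = -Ω²`. [cite: McDuffSalamon2017, Prop. 2.5.6 (2.5.13)] -/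
theorem polarSqrt_mul_polarSqrt : polarSqrt Ω * polarSqrt Ω = -(Ω * Ω) :=
  h.isPosDefSymm_neg_mul_self.posSqrt_mul_posSqrt

/-- `Q` commutes with `Ω`. [cite: McDuffSalamon2017, Prop. 2.5.6 Step 1] -/
theorem polarSqrt_comm : Ω * polarSqrt Ω = polarSqrt Ω * Ω :=
  posSqrt_comm_of_comm h.isPosDefSymm_neg_mul_self (by noncomm_ring)

/-- `Q⁻¹ · Q = 1`. [folklore] -/
theorem inverse_polarSqrt_mul : Ring.inverse (polarSqrt Ω) * polarSqrt Ω = 1 :=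
  Ring.inverse_mul_cancel _ (isPosDefSymm_polarSqrt h).isUnit

/-- `Q · Q⁻¹ = 1`. [folklore] -/
theorem polarSqrt_mul_inverse : polarSqrt Ω * Ring.inverse (polarSqrt Ω) = 1 :=
  Ring.mul_inverse_cancel _ (isPosDefSymm_polarSqrt h).isUnit

/-- `Q⁻¹` commutes with `Ω`. [folklore] -/
theorem inverse_polarSqrt_comm : Ring.inverse (polarSqrt Ω) * Ω = Ω * Ring.inverse (polarSqrt Ω) := by
  have h1 := polarSqrt_comm h
  have h2 := inverse_polarSqrt_mul h
  have h3 := polarSqrt_mul_inverse h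
  calc Ring.inverse (polarSqrt Ω) * Ω
      = Ring.inverse (polarSqrt Ω) * Ω * (polarSqrt Ω * Ring.inverse (polarSqrt Ω)) := by
        rw [h3, mul_one]
    _ = Ring.inverse (polarSqrt Ω) * (Ω * polarSqrt Ω) * Ring.inverse (polarSqrt Ω) := by
        noncomm_ring
    _ = Ring.inverse (polarSqrt Ω) * (polarSqrt Ω * Ω) * Ring.inverse (polarSqrt Ω) := by rw [h1]
    _ = (Ring.inverse (polarSqrt Ω) * polarSqrt Ω) * Ω * Ring.inverse (polarSqrt Ω) := by
        noncomm_ring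
    _ = Ω * Ring.inverse (polarSqrt Ω) := by rw [h2, one_mul]

/-- **`J² = -1`**: `Q⁻¹ Ω Q⁻¹ Ω = Q⁻² Ω² = -Q⁻² Q² = -1`. [cite: McDuffSalamon2017, Prop. 2.5.6 Step 1] -/
theorem polarJ_mul_polarJ : polarJ Ω * polarJ Ω = -1 := by
  have h1 := inverse_polarSqrt_comm h
  have h2 := inverse_polarSqrt_mul h
  have h4 : Ω * Ω = -(polarSqrt Ω * polarSqrt Ω) := by rw [polarSqrt_mul_polarSqrt h, neg_neg]
  unfold polarJ
  calc Ring.inverse (polarSqrt Ω) * Ω * (Ring.inverse (polarSqrt Ω) * Ω)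
      = Ring.inverse (polarSqrt Ω) * (Ω * Ring.inverse (polarSqrt Ω)) * Ω := by noncomm_ring
    _ = Ring.inverse (polarSqrt Ω) * (Ring.inverse (polarSqrt Ω) * Ω) * Ω := by rw [h1]
    _ = Ring.inverse (polarSqrt Ω) * Ring.inverse (polarSqrt Ω) * (Ω * Ω) := by noncomm_ring
    _ = -(Ring.inverse (polarSqrt Ω) * (Ring.inverse (polarSqrt Ω) * polarSqrt Ω) * polarSqrt Ω) := by
        rw [h4]; noncomm_ring
    _ = -1 := by rw [h2, mul_one, h2]

/-- `J (J v) = -v`. [cite: McDuffSalamon2017, Prop. 2.5.6 Step 1] -/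
theorem polarJ_polarJ_apply (v : E) : polarJ Ω (polarJ Ω v) = -v := by
  have := congrArg (fun T : E →L[ℝ] E ↦ T v) (polarJ_mul_polarJ h)
  exact this

/-- `Q⁻¹` is symmetric positive definite. [folklore] -/
theorem isPosDefSymm_inverse_polarSqrt : IsPosDefSymm (Ring.inverse (polarSqrt Ω)) :=
  (isPosDefSymm_polarSqrt h).ringInverse

/-- **`J` preserves `ω`**: `⟪Ω (J v), J w⟫ = ⟪Ω v, w⟫` (McDuff–Salamon 2017, (2.5.10):
`J ∈ 𝒥(V, ω)`). [cite: McDuffSalamon2017, Prop. 2.5.6 (2.5.10)] -/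
theorem inner_gram_polarJ (v w : E) : ⟪Ω (polarJ Ω v), polarJ Ω w⟫ = ⟪Ω v, w⟫ := by
  have hR := isPosDefSymm_inverse_polarSqrt h
  change ⟪Ω (Ring.inverse (polarSqrt Ω) (Ω v)), Ring.inverse (polarSqrt Ω) (Ω w)⟫ = ⟪Ω v, w⟫
  rw [← hR.symm]
  change ⟪polarJ Ω (polarJ Ω v), Ω w⟫ = _
  rw [polarJ_polarJ_apply h, inner_neg_left, ← h.skew]

/-- **`J` is tamed by `ω`**: `⟪Ω v, J v⟫ > 0` for `v ≠ 0` (McDuff–Salamon 2017, (2.5.10):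
"`ω(·, J·) = g(A·, J·) = g(QJ·, J·)` is an inner product"). [cite: McDuffSalamon2017, Prop. 2.5.6 (2.5.10)] -/
theorem inner_gram_self_polarJ_pos {v : E} (hv : v ≠ 0) : 0 < ⟪Ω v, polarJ Ω v⟫ := by
  have hR := isPosDefSymm_inverse_polarSqrt h
  change 0 < ⟪Ω v, Ring.inverse (polarSqrt Ω) (Ω v)⟫
  rw [real_inner_comm]
  exact hR.pos _ (h.ne_zero v hv)

/-- **`J` is orthogonal**: `⟪J v, J w⟫ = ⟪v, w⟫` (McDuff–Salamon 2017, (2.5.10): `J ∈ 𝒥(V, g)`,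
`J* = -J`). [cite: McDuffSalamon2017, Prop. 2.5.6 (2.5.10)] -/
theorem inner_polarJ (v w : E) : ⟪polarJ Ω v, polarJ Ω w⟫ = ⟪v, w⟫ := by
  have hR := isPosDefSymm_inverse_polarSqrt h
  have h2 := inverse_polarSqrt_comm h
  have h3 := inverse_polarSqrt_mul h
  have h4 : Ω * Ω = -(polarSqrt Ω * polarSqrt Ω) := by rw [polarSqrt_mul_polarSqrt h, neg_neg]
  have h5 : Ω * Ring.inverse (polarSqrt Ω) * Ring.inverse (polarSqrt Ω) * Ω = -1 := by
    calc Ω * Ring.inverse (polarSqrt Ω) * Ring.inverse (polarSqrt Ω) * Ω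
        = (Ω * Ring.inverse (polarSqrt Ω)) * (Ring.inverse (polarSqrt Ω) * Ω) := by noncomm_ring
      _ = (Ring.inverse (polarSqrt Ω) * Ω) * (Ring.inverse (polarSqrt Ω) * Ω) := by rw [← h2]
      _ = Ring.inverse (polarSqrt Ω) * (Ω * Ring.inverse (polarSqrt Ω)) * Ω := by noncomm_ring
      _ = Ring.inverse (polarSqrt Ω) * (Ring.inverse (polarSqrt Ω) * Ω) * Ω := by rw [← h2]
      _ = -(Ring.inverse (polarSqrt Ω) * (Ring.inverse (polarSqrt Ω) * polarSqrt Ω) * polarSqrt Ω) := by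
          rw [show Ring.inverse (polarSqrt Ω) * (Ring.inverse (polarSqrt Ω) * Ω) * Ω =
            Ring.inverse (polarSqrt Ω) * Ring.inverse (polarSqrt Ω) * (Ω * Ω) by noncomm_ring, h4]
          noncomm_ring
      _ = -1 := by rw [h3, mul_one, h3]
  have h1 : Ω (Ring.inverse (polarSqrt Ω) (Ring.inverse (polarSqrt Ω) (Ω w))) = -w :=
    congrArg (fun T : E →L[ℝ] E ↦ T w) h5
  change ⟪Ring.inverse (polarSqrt Ω) (Ω v), Ring.inverse (polarSqrt Ω) (Ω w)⟫ = ⟪v, w⟫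
  rw [hR.symm, h.skew, h1, inner_neg_right, neg_neg]

end Euclidean

/-! ### The metric version `J_{g,ω} = C⁻¹ · polarJ (C⁻¹ Ω C⁻¹) · C`, `C = G^{1/2}` -/

/-- The `g`-orthonormalised Gram operator `Ω̃ := C⁻¹ Ω C⁻¹` (`C = G^{1/2}`): the Gram operator of
`ω` in the Euclidean structure `g` transported by the isometry `C : (E, g) → (E, ⟪·,·⟫)`. [folklore] -/
def conjGram (G Ω : E →L[ℝ] E) : E →L[ℝ] E :=
  Ring.inverse (posSqrt G) * Ω * Ring.inverse (posSqrt G)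

/-- **`J_{g,ω}`** for the inner product `g = ⟪G·, ·⟫` and the form `ω = ⟪Ω·, ·⟫`
(McDuff–Salamon 2017, (2.5.14)): `C⁻¹ · polarJ (C⁻¹ Ω C⁻¹) · C` with `C = G^{1/2}`, i.e. the
Euclidean construction in a `g`-orthonormal frame. [cite: McDuffSalamon2017, Prop. 2.5.6 (2.5.14)] -/
def polarJOfMetric (G Ω : E →L[ℝ] E) : E →L[ℝ] E :=
  Ring.inverse (posSqrt G) * polarJ (conjGram G Ω) * posSqrt G

section Metric

variable {G Ω : E →L[ℝ] E} (hG : IsPosDefSymm G) (hΩ : IsSkewNondeg Ω)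
include hG hΩ

/-- `Ω̃ = C⁻¹ Ω C⁻¹` is skew nondegenerate. [folklore] -/
theorem isSkewNondeg_conjGram : IsSkewNondeg (conjGram G Ω) := by
  have hC := hG.isPosDefSymm_posSqrt
  have hCi := hC.ringInverse
  refine ⟨fun x y ↦ ?_, fun v hv ↦ ?_⟩
  · change ⟪Ring.inverse (posSqrt G) (Ω (Ring.inverse (posSqrt G) x)), y⟫ =
      -⟪x, Ring.inverse (posSqrt G) (Ω (Ring.inverse (posSqrt G) y))⟫
    rw [hCi.symm, hΩ.skew, ← hCi.symm]
  · change Ring.inverse (posSqrt G) (Ω (Ring.inverse (posSqrt G) v)) ≠ 0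
    exact hCi.apply_ne_zero (hΩ.ne_zero _ (hCi.apply_ne_zero hv))

omit hΩ in
/-- `C⁻¹ (C v) = v`. [folklore] -/
theorem inverse_posSqrt_apply_posSqrt (v : E) : Ring.inverse (posSqrt G) (posSqrt G v) = v := by
  have := congrArg (fun T : E →L[ℝ] E ↦ T v)
    (Ring.inverse_mul_cancel _ hG.isPosDefSymm_posSqrt.isUnit)
  exact this

omit hΩ in
/-- `C (C⁻¹ v) = v`. [folklore] -/
theorem posSqrt_apply_inverse_posSqrt (v : E) : posSqrt G (Ring.inverse (posSqrt G) v) = v := by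
  have := congrArg (fun T : E →L[ℝ] E ↦ T v)
    (Ring.mul_inverse_cancel _ hG.isPosDefSymm_posSqrt.isUnit)
  exact this

omit hΩ in
/-- `g(v, w) = ⟪C v, C w⟫`: `C = G^{1/2}` is an isometry `(E, g) → (E, ⟪·,·⟫)`. [folklore] -/
theorem inner_posSqrt_posSqrt (v w : E) : ⟪posSqrt G v, posSqrt G w⟫ = ⟪G v, w⟫ := by
  have h2 : posSqrt G (posSqrt G w) = G w := congrArg (fun T : E →L[ℝ] E ↦ T w) hG.posSqrt_mul_posSqrt
  rw [hG.isPosDefSymm_posSqrt.symm v (posSqrt G w), h2, ← hG.symm]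

omit hG hΩ in
/-- Unfolding `J v = C⁻¹ (J̃ (C v))`. [folklore] -/
theorem polarJOfMetric_apply (v : E) :
    polarJOfMetric G Ω v = Ring.inverse (posSqrt G) (polarJ (conjGram G Ω) (posSqrt G v)) := rfl

/-- **`J_{g,ω}² = -1`.** [cite: McDuffSalamon2017, Prop. 2.5.6 Step 1] -/
theorem polarJOfMetric_polarJOfMetric_apply (v : E) :
    polarJOfMetric G Ω (polarJOfMetric G Ω v) = -v := by
  rw [polarJOfMetric_apply, polarJOfMetric_apply, posSqrt_apply_inverse_posSqrt hG,
    polarJ_polarJ_apply (isSkewNondeg_conjGram hG hΩ), map_neg, inverse_posSqrt_apply_posSqrt hG]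

/-- `J_{g,ω} · J_{g,ω} = -1`. [cite: McDuffSalamon2017, Prop. 2.5.6 Step 1] -/
theorem polarJOfMetric_mul_self : polarJOfMetric G Ω * polarJOfMetric G Ω = -1 :=
  ContinuousLinearMap.ext fun v ↦ polarJOfMetric_polarJOfMetric_apply hG hΩ v

/-- **`J_{g,ω}` preserves `ω`**: `⟪Ω (J v), J w⟫ = ⟪Ω v, w⟫`. [cite: McDuffSalamon2017, Prop. 2.5.6 (2.5.10)] -/
theorem inner_gram_polarJOfMetric (v w : E) :
    ⟪Ω (polarJOfMetric G Ω v), polarJOfMetric G Ω w⟫ = ⟪Ω v, w⟫ := by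
  have hCi := hG.isPosDefSymm_posSqrt.ringInverse
  have ht := isSkewNondeg_conjGram hG hΩ
  rw [polarJOfMetric_apply, polarJOfMetric_apply, ← hCi.symm]
  have key := inner_gram_polarJ ht (posSqrt G v) (posSqrt G w)
  change ⟪Ring.inverse (posSqrt G) (Ω (Ring.inverse (posSqrt G) (polarJ (conjGram G Ω) (posSqrt G v)))),
      polarJ (conjGram G Ω) (posSqrt G w)⟫ =
    ⟪Ring.inverse (posSqrt G) (Ω (Ring.inverse (posSqrt G) (posSqrt G v))), posSqrt G w⟫ at key
  rw [key, inverse_posSqrt_apply_posSqrt hG, hCi.symm, inverse_posSqrt_apply_posSqrt hG]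

/-- **`J_{g,ω}` is tamed by `ω`**: `⟪Ω v, J v⟫ > 0` for `v ≠ 0`. [cite: McDuffSalamon2017, Prop. 2.5.6 (2.5.10)] -/
theorem inner_gram_self_polarJOfMetric_pos {v : E} (hv : v ≠ 0) :
    0 < ⟪Ω v, polarJOfMetric G Ω v⟫ := by
  have hC := hG.isPosDefSymm_posSqrt
  have hCi := hC.ringInverse
  have ht := isSkewNondeg_conjGram hG hΩ
  rw [polarJOfMetric_apply, ← hCi.symm]
  have key := inner_gram_self_polarJ_pos ht (hC.apply_ne_zero hv)
  change 0 < ⟪Ring.inverse (posSqrt G) (Ω (Ring.inverse (posSqrt G) (posSqrt G v))),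
    polarJ (conjGram G Ω) (posSqrt G v)⟫ at key
  rwa [inverse_posSqrt_apply_posSqrt hG] at key

/-- **`J_{g,ω}` is `g`-orthogonal**: `g(J v, J w) = g(v, w)`. [cite: McDuffSalamon2017, Prop. 2.5.6 (2.5.10)] -/
theorem inner_metric_polarJOfMetric (v w : E) :
    ⟪G (polarJOfMetric G Ω v), polarJOfMetric G Ω w⟫ = ⟪G v, w⟫ := by
  have ht := isSkewNondeg_conjGram hG hΩ
  rw [← inner_posSqrt_posSqrt hG, polarJOfMetric_apply, polarJOfMetric_apply,
    posSqrt_apply_inverse_posSqrt hG, posSqrt_apply_inverse_posSqrt hG, inner_polarJ ht,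
    inner_posSqrt_posSqrt hG]

end Metric

/-! ### Uniqueness: `𝒥(V, ω) ∩ 𝒥(V, g) = {J_{g,ω}}`, and `GL`-equivariance -/

section Unique

/-- **Uniqueness of the Euclidean polar part.** A complex structure `J'` (`J'² = -1`) which
preserves `ω` (`⟪Ω (J' v), J' w⟫ = ⟪Ω v, w⟫`), is tamed by it (`⟪Ω v, J' v⟫ > 0`) and is
orthogonal (`⟪J' v, J' w⟫ = ⟪v, w⟫`) equals `polarJ Ω`: `Q' := -Ω J'` is then a symmetric
positive definite square root of `-Ω²`, hence `Q' = Q` (uniqueness of positive square roots),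
and `J' = Q⁻¹ Ω` (McDuff–Salamon 2017, Prop. 2.5.6 (i), (2.5.11); Exercise 2.5.15).
[cite: McDuffSalamon2017, Prop. 2.5.6 (i)] -/
theorem eq_polarJ {Ω J' : E →L[ℝ] E} (h : IsSkewNondeg Ω) (hsq : J' * J' = -1)
    (hinv : ∀ v w, ⟪Ω (J' v), J' w⟫ = ⟪Ω v, w⟫) (htame : ∀ v, v ≠ 0 → 0 < ⟪Ω v, J' v⟫)
    (horth : ∀ v w, ⟪J' v, J' w⟫ = ⟪v, w⟫) : J' = polarJ Ω := by
  have hJJ : ∀ v, J' (J' v) = -v := fun v ↦ congrArg (fun T : E →L[ℝ] E ↦ T v) hsq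
  -- `J'` is skew
  have hJskew : ∀ x z, ⟪J' x, z⟫ = -⟪x, J' z⟫ := by
    intro x z
    have h1 := horth x (J' z)
    rw [hJJ, inner_neg_right] at h1
    linarith
  -- `Ω J' = J' Ω`
  have hcomm : Ω * J' = J' * Ω := by
    have h1 : ∀ v, -(J' (Ω (J' v))) = Ω v := by
      intro v
      refine ext_inner_right ℝ fun w ↦ ?_
      rw [inner_neg_left, hJskew, neg_neg, hinv]
    refine ContinuousLinearMap.ext fun v ↦ ?_
    change Ω (J' v) = J' (Ω v)
    have h5 := congrArg J' (h1 v)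
    rw [map_neg, hJJ, neg_neg] at h5
    exact h5
  -- `Q' := -Ω J'` is symmetric positive definite with `Q'² = -Ω²`
  set Q' : E →L[ℝ] E := -(Ω * J') with hQ'
  have hQ'symm : ∀ x y, ⟪Q' x, y⟫ = ⟪x, Q' y⟫ := by
    intro x y
    change ⟪-(Ω (J' x)), y⟫ = ⟪x, -(Ω (J' y))⟫
    have h1 := hinv x (J' y)
    rw [hJJ, inner_neg_right] at h1
    rw [inner_neg_left, inner_neg_right, h1, h.skew x (J' y)]
  have hQ'pos : ∀ v, v ≠ 0 → 0 < ⟪Q' v, v⟫ := by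
    intro v hv
    change 0 < ⟪-(Ω (J' v)), v⟫
    rw [inner_neg_left, h.skew (J' v) v, neg_neg, real_inner_comm (Ω v) (J' v)]
    exact htame v hv
  have hQ'pd : IsPosDefSymm Q' := ⟨hQ'symm, hQ'pos⟩
  have hQ'sq : Q' * Q' = -(Ω * Ω) := by
    rw [hQ']
    calc -(Ω * J') * -(Ω * J') = Ω * J' * (Ω * J') := by noncomm_ring
      _ = Ω * (J' * Ω) * J' := by noncomm_ring
      _ = Ω * (Ω * J') * J' := by rw [← hcomm]
      _ = Ω * Ω * (J' * J') := by noncomm_ring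
      _ = -(Ω * Ω) := by rw [hsq]; noncomm_ring
  have hQ'eq : Q' = polarSqrt Ω := h.isPosDefSymm_neg_mul_self.posSqrt_unique hQ'pd hQ'sq
  -- `Q' J' = ... `: from `Q' = -Ω J'`, `Q' * J' = -Ω J' J' = Ω`, so `J' = Q'⁻¹ Ω`
  have hQJ : polarSqrt Ω * J' = Ω := by
    rw [← hQ'eq, hQ']
    calc -(Ω * J') * J' = -(Ω * (J' * J')) := by noncomm_ring
      _ = Ω := by rw [hsq]; noncomm_ring
  calc J' = Ring.inverse (polarSqrt Ω) * polarSqrt Ω * J' := by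
        rw [inverse_polarSqrt_mul h, one_mul]
    _ = Ring.inverse (polarSqrt Ω) * (polarSqrt Ω * J') := by rw [mul_assoc]
    _ = polarJ Ω := by rw [hQJ]; rfl

/-- **Uniqueness of `J_{g,ω}`**: a complex structure `J'` preserving `ω`, tamed by `ω` and
`g`-orthogonal is `polarJOfMetric G Ω` (transport the Euclidean uniqueness `eq_polarJ` along the
isometry `C = G^{1/2}`). [cite: McDuffSalamon2017, Prop. 2.5.6 (i)] -/
theorem eq_polarJOfMetric {G Ω J' : E →L[ℝ] E} (hG : IsPosDefSymm G) (hΩ : IsSkewNondeg Ω)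
    (hsq : J' * J' = -1) (hinv : ∀ v w, ⟪Ω (J' v), J' w⟫ = ⟪Ω v, w⟫)
    (htame : ∀ v, v ≠ 0 → 0 < ⟪Ω v, J' v⟫) (horth : ∀ v w, ⟪G (J' v), J' w⟫ = ⟪G v, w⟫) :
    J' = polarJOfMetric G Ω := by
  have hC := hG.isPosDefSymm_posSqrt
  have hCi := hC.ringInverse
  have ht := isSkewNondeg_conjGram hG hΩ
  -- the transported structure `J̃' := C J' C⁻¹`
  set K : E →L[ℝ] E := posSqrt G * J' * Ring.inverse (posSqrt G) with hK
  have hKapp : ∀ v, K v = posSqrt G (J' (Ring.inverse (posSqrt G) v)) := fun v ↦ rfl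
  have hJJ : ∀ v, J' (J' v) = -v := fun v ↦ congrArg (fun T : E →L[ℝ] E ↦ T v) hsq
  have hKsq : K * K = -1 := by
    refine ContinuousLinearMap.ext fun v ↦ ?_
    change K (K v) = -v
    rw [hKapp, hKapp, inverse_posSqrt_apply_posSqrt hG, hJJ, map_neg,
      posSqrt_apply_inverse_posSqrt hG]
  have hKinv : ∀ v w, ⟪conjGram G Ω (K v), K w⟫ = ⟪conjGram G Ω v, w⟫ := by
    intro v w
    change ⟪Ring.inverse (posSqrt G) (Ω (Ring.inverse (posSqrt G) (K v))), K w⟫ =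
      ⟪Ring.inverse (posSqrt G) (Ω (Ring.inverse (posSqrt G) v)), w⟫
    rw [hKapp, hKapp, inverse_posSqrt_apply_posSqrt hG, hCi.symm, inverse_posSqrt_apply_posSqrt hG,
      hinv, hCi.symm]
  have hKtame : ∀ v, v ≠ 0 → 0 < ⟪conjGram G Ω v, K v⟫ := by
    intro v hv
    change 0 < ⟪Ring.inverse (posSqrt G) (Ω (Ring.inverse (posSqrt G) v)), K v⟫
    rw [hKapp, hCi.symm, inverse_posSqrt_apply_posSqrt hG]
    exact htame _ (hCi.apply_ne_zero hv)
  have hKorth : ∀ v w, ⟪K v, K w⟫ = ⟪v, w⟫ := by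
    intro v w
    rw [hKapp, hKapp, inner_posSqrt_posSqrt hG, horth, ← inner_posSqrt_posSqrt hG,
      posSqrt_apply_inverse_posSqrt hG, posSqrt_apply_inverse_posSqrt hG]
  have hKeq : K = polarJ (conjGram G Ω) := eq_polarJ ht hKsq hKinv hKtame hKorth
  -- undo the transport
  have h1 : J' = Ring.inverse (posSqrt G) * K * posSqrt G := by
    rw [hK]
    calc J' = (Ring.inverse (posSqrt G) * posSqrt G) * J' * (Ring.inverse (posSqrt G) * posSqrt G) := by
          rw [Ring.inverse_mul_cancel _ hC.isUnit, one_mul, mul_one]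
      _ = Ring.inverse (posSqrt G) * (posSqrt G * J' * Ring.inverse (posSqrt G)) * posSqrt G := by
          noncomm_ring
  rw [h1, hKeq]
  rfl

end Unique

section Equivariance

variable [CompleteSpace E]

open ContinuousLinearMap in
/-- **`GL`-equivariance of `(g, ω) ↦ J_{g,ω}`** (McDuff–Salamon 2017, Prop. 2.5.6:
`J_{Φ^*g, Φ^*ω} = Φ⁻¹ J_{g,ω} Φ`; here with push-forwards): for a linear automorphism `Φ`, the Gram
operators of the transported metric `g(Φ⁻¹·, Φ⁻¹·)` and form `ω(Φ⁻¹·, Φ⁻¹·)` are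
`(Φ⁻¹)† G Φ⁻¹` and `(Φ⁻¹)† Ω Φ⁻¹`, and their `J` is `Φ J_{g,ω} Φ⁻¹` — by uniqueness
(`eq_polarJOfMetric`). [cite: McDuffSalamon2017, Prop. 2.5.6] -/
theorem polarJOfMetric_conj {G Ω : E →L[ℝ] E} (hG : IsPosDefSymm G) (hΩ : IsSkewNondeg Ω)
    (Φ : E ≃L[ℝ] E) :
    polarJOfMetric (adjoint (Φ.symm : E →L[ℝ] E) * G * (Φ.symm : E →L[ℝ] E))
        (adjoint (Φ.symm : E →L[ℝ] E) * Ω * (Φ.symm : E →L[ℝ] E)) =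
      (Φ : E →L[ℝ] E) * polarJOfMetric G Ω * (Φ.symm : E →L[ℝ] E) := by
  set Ψ : E →L[ℝ] E := (Φ.symm : E →L[ℝ] E) with hΨ
  set G' : E →L[ℝ] E := adjoint Ψ * G * Ψ with hG'
  set Ω' : E →L[ℝ] E := adjoint Ψ * Ω * Ψ with hΩ'
  have hΨΦ : ∀ v, Ψ (Φ v) = v := fun v ↦ Φ.symm_apply_apply v
  have hΦΨ : ∀ v, Φ (Ψ v) = v := fun v ↦ Φ.apply_symm_apply v
  have hΨinj : ∀ v, v ≠ 0 → Ψ v ≠ 0 := fun v hv h0 ↦ hv (by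
    have h1 := congrArg Φ h0
    rwa [hΦΨ, map_zero] at h1)
  have hG'app : ∀ v w, ⟪G' v, w⟫ = ⟪G (Ψ v), Ψ w⟫ := fun v w ↦ by
    change ⟪adjoint Ψ (G (Ψ v)), w⟫ = _
    rw [adjoint_inner_left]
  have hΩ'app : ∀ v w, ⟪Ω' v, w⟫ = ⟪Ω (Ψ v), Ψ w⟫ := fun v w ↦ by
    change ⟪adjoint Ψ (Ω (Ψ v)), w⟫ = _
    rw [adjoint_inner_left]
  have hG'pd : IsPosDefSymm G' := by
    refine ⟨fun x y ↦ ?_, fun v hv ↦ ?_⟩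
    · rw [hG'app, ← real_inner_comm x (G' y), hG'app, hG.symm (Ψ y) (Ψ x)]
      exact real_inner_comm _ _
    · rw [hG'app]
      exact hG.pos _ (hΨinj v hv)
  have hΩ'sk : IsSkewNondeg Ω' := by
    refine ⟨fun x y ↦ ?_, fun v hv ↦ ?_⟩
    · rw [hΩ'app, hΩ.skew, ← real_inner_comm x (Ω' y), hΩ'app]
      congr 1
      exact real_inner_comm _ _
    · intro h0
      have h1 : ⟪Ω' v, Φ (Ω (Ψ v))⟫ = 0 := by rw [h0, inner_zero_left]
      rw [hΩ'app, hΨΦ, inner_self_eq_zero] at h1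
      exact hΩ.ne_zero _ (hΨinj v hv) h1
  -- the candidate `Φ J Φ⁻¹`
  set K : E →L[ℝ] E := (Φ : E →L[ℝ] E) * polarJOfMetric G Ω * Ψ with hK
  have hKapp : ∀ v, K v = Φ (polarJOfMetric G Ω (Ψ v)) := fun v ↦ rfl
  have hJJ := polarJOfMetric_polarJOfMetric_apply hG hΩ
  have hKsq : K * K = -1 := by
    refine ContinuousLinearMap.ext fun v ↦ ?_
    change K (K v) = -v
    rw [hKapp, hKapp, hΨΦ, hJJ, map_neg, hΦΨ]
  have hKinv : ∀ v w, ⟪Ω' (K v), K w⟫ = ⟪Ω' v, w⟫ := by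
    intro v w
    rw [hΩ'app, hΩ'app, hKapp, hKapp, hΨΦ, hΨΦ, inner_gram_polarJOfMetric hG hΩ]
  have hKtame : ∀ v, v ≠ 0 → 0 < ⟪Ω' v, K v⟫ := by
    intro v hv
    rw [hΩ'app, hKapp, hΨΦ]
    exact inner_gram_self_polarJOfMetric_pos hG hΩ (hΨinj v hv)
  have hKorth : ∀ v w, ⟪G' (K v), K w⟫ = ⟪G' v, w⟫ := by
    intro v w
    rw [hG'app, hG'app, hKapp, hKapp, hΨΦ, hΨΦ, inner_metric_polarJOfMetric hG hΩ]
  exact (eq_polarJOfMetric hG'pd hΩ'sk hKsq hKinv hKtame hKorth).symm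

end Equivariance

/-! ### Smoothness of `(G, Ω) ↦ J_{g,ω}` -/

section Smooth

variable [CompleteSpace E]

/-- The domain of `(G, Ω) ↦ J_{g,ω}`: `G` symmetric positive definite, `Ω` skew nondegenerate.
[folklore] -/
def polarDomain (E : Type*) [NormedAddCommGroup E] [InnerProductSpace ℝ E] :
    Set ((E →L[ℝ] E) × (E →L[ℝ] E)) :=
  {p | IsPosDefSymm p.1 ∧ IsSkewNondeg p.2}

/-- **The map `(g, ω) ↦ J_{g,ω}` is smooth** (McDuff–Salamon 2017, Prop. 2.5.6: "the map
(2.5.9) is smooth", Exercise 2.5.15): `(G, Ω) ↦ polarJOfMetric G Ω` is `C^∞` on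
`{G symmetric positive definite} × {Ω skew nondegenerate}` — a composite of the smooth maps
`posSqrt` and `(posSqrt ·)⁻¹` on positive definite operators (`contDiffOn_posSqrt`,
`contDiffOn_inverse_posSqrt`) with products. [cite: McDuffSalamon2017, Prop. 2.5.6] -/
theorem contDiffOn_polarJOfMetric :
    ContDiffOn ℝ ∞ (fun p : (E →L[ℝ] E) × (E →L[ℝ] E) ↦ polarJOfMetric p.1 p.2) (polarDomain E) := by
  -- `p ↦ C = √G` and `p ↦ C⁻¹`
  have hC : ContDiffOn ℝ ∞ (fun p : (E →L[ℝ] E) × (E →L[ℝ] E) ↦ posSqrt p.1) (polarDomain E) :=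
    contDiffOn_posSqrt.comp contDiffOn_fst fun p hp ↦ hp.1
  have hCi : ContDiffOn ℝ ∞ (fun p : (E →L[ℝ] E) × (E →L[ℝ] E) ↦ Ring.inverse (posSqrt p.1))
      (polarDomain E) :=
    contDiffOn_inverse_posSqrt.comp contDiffOn_fst fun p hp ↦ hp.1
  -- `p ↦ Ω̃ = C⁻¹ Ω C⁻¹`
  have hT : ContDiffOn ℝ ∞ (fun p : (E →L[ℝ] E) × (E →L[ℝ] E) ↦ conjGram p.1 p.2) (polarDomain E) :=
    (hCi.mul contDiffOn_snd).mul hCi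
  -- `p ↦ -Ω̃²` takes values in the positive definite operators
  have hP : ContDiffOn ℝ ∞ (fun p : (E →L[ℝ] E) × (E →L[ℝ] E) ↦ -(conjGram p.1 p.2 * conjGram p.1 p.2))
      (polarDomain E) := (hT.mul hT).neg
  have hPmaps : Set.MapsTo (fun p : (E →L[ℝ] E) × (E →L[ℝ] E) ↦ -(conjGram p.1 p.2 * conjGram p.1 p.2))
      (polarDomain E) {T : E →L[ℝ] E | IsPosDefSymm T} :=
    fun p hp ↦ (isSkewNondeg_conjGram hp.1 hp.2).isPosDefSymm_neg_mul_self
  -- `p ↦ (√(-Ω̃²))⁻¹`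
  have hR : ContDiffOn ℝ ∞
      (fun p : (E →L[ℝ] E) × (E →L[ℝ] E) ↦ Ring.inverse (posSqrt (-(conjGram p.1 p.2 * conjGram p.1 p.2))))
      (polarDomain E) :=
    contDiffOn_inverse_posSqrt.comp hP hPmaps
  -- assemble
  have hJ : ContDiffOn ℝ ∞ (fun p : (E →L[ℝ] E) × (E →L[ℝ] E) ↦ polarJ (conjGram p.1 p.2))
      (polarDomain E) := hR.mul hT
  exact (hCi.mul hJ).mul hC

end Smooth

end Literature.Geometry.Symplectic

end
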